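import Literature.NumberTheory.Rogawski1990.ArchOrbFamGExtBoxDescentFaces         -- ★ p851313 (this seat): the ONE-corner edition; brings ★ p851168 (dock `hcExtendG_eqOn_of_continuousOn`, `isCompact_setOf_exists_conj_cayleyTorus_mem`), ★ p851298, ★ (A5a″)
import Literature.NumberTheory.Rogawski1990.ArchLocalWallDescentParamPi             -- ★ p851437 (X-core) L1^ι `exists_descent_box_local_param_pi` (this seat)
import Literature.NumberTheory.Rogawski1990.ArchOrbFamGHeldOutFamilyFinset            -- ★ p851457 (this seat): L3^E §1–§2 `exists_smooth_heldOut_family_finset`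
import Literature.NumberTheory.Rogawski1990.ArchOrbFamGUnfoldedModelHeldOutFinsetPiIterated  -- ★ p851454 (F0P3b-p01 (g17)): L2^E (A5a″)^E `orbFamG_eq_integral_unfoldedModel_heldOutFinsetPi_of_regG`
import HarnessLib

/-!
# (X-core) L3^E — box descent of the EXTENDED genuine family at CROSS-PLACE CORNERS (several compact places on the noncompact wall at once, real walls at the
# split places allowed), on `U ∩ InRegG` (Rogawski 1990 §8.2; Harish-Chandra's compactness lemma; Varadarajan 1977 I §1.12; Bouaziz 1994 §3.1–3.2)

Topic `NumberTheory/Rogawski1990`; namespace `Literature.NumberTheory.Rogawski1990`.  THEOREMS ONLY (no `def`, no instance, no notation, no axiom, no named fact,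
no `sorry`); kernel lane `--kind proof --supports stmt-HodgeConjecture-24833`.  Cell `pub/hodgecm-mathlib`, crux H413 (`stmt-HodgeConjecture-24833`), F0∕P3c line LH3
(closer stub `stub_N9`, DIRECT ROAD `F0_P3c_StubN9Direct`), organ **O-L1e-b «(I₁) AT CROSS-PLACE CORNERS MEETING A REAL WALL»** (LH3-plan (g4) DEAL BY NAME 2026-09-02T12:00:29Z:
(X-core) road owner LH5-p02 (g4); hands L1^ι ★ `ArchLocalWallDescentParamPi` (this seat), L2^E F0P3b-p01 (g17) `ArchOrbFamGUnfoldedModelHeldOutFinset`, L3^E + head = this file;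
face-side consumer F0P3a-p02 (g21), who types Layer A′∕B′ against the head below).  Binder of record for the head: LH5-p02 (g4).

THE MATHEMATICS.  ★ p851313 `exists_descent_box_orbFamGExt_inRegG` descends the extended genuine chart family `orbFamGExt` near a point `x` with ONE compact place `w₀` on the
noncompact wall `(0,2)`.  Here a finite set `E` of compact-chart places sits on that wall at once (`x_w 0 = x_w 2`, `e^{i x_w 1} ≠ e^{i x_w 0}` for `w ∈ E`; every other compact
place in-regular; the split places `S` arbitrary — real walls allowed).  The road is the same three hands: L2^E unfolds the split places parabolically with the places of `E`
HELD OUT as local quotient orbital integrals of a family that is jointly smooth in the coordinates and in the held-out conjugates (★ (A4′)); L1^ι descends the `E` places at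
once; the dock ★ `hcExtendG_eqOn_of_continuousOn` passes from `U ∩ RegG` to `U ∩ InRegG` by continuity of the model off the corner walls (§1).
* §1 (H-cont)^E: the corner model `c ↦ Φ_E(c) · K · ∫_{U(J)^E} f(c, (h_w T(c_w) h_w⁻¹)_w) dμ₀^{⊗E}` is continuous off the corner walls (properness in `U(J)` factor by factor).
* §2 the dock at corners: `exists_descent_box_orbFamGExt_inRegG_corners_of_core`.
* §3 the core package on `U ∩ RegG` (L2^E ∘ held-out family ∘ cut-off ∘ L1^ι): `exists_descent_box_orbFamG_cornerPackage`.
* §4 the head **`exists_descent_box_orbFamGExt_inRegG_corners`**.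
HONEST LABEL: HC_CM is proved only modulo the 7 printed citations (2 remaining: hLiu418 = `stmt-HodgeConjecture-24832`, h413 = `stmt-HodgeConjecture-24833`) until rung 0
closes; count-neutral letter-L1 plumbing for organ O-L1e-b.

## References
* [Rogawski1990] J. D. Rogawski, *Automorphic Representations of Unitary Groups in Three Variables*, Ann. of Math. Stud. 123 (1990), §4.12 Lemma 4.12.1 p. 61, §8.2 pp. 119–124.
* [Varadarajan1977] V. S. Varadarajan, *Harmonic Analysis on Real Reductive Groups*, LNM 576 (1977), Part I §1.12 (the invariant integral extends continuously across the
  compact and real walls).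
* [Shelstad1979] D. Shelstad, *Characters and inner forms of a quasi-split group over ℝ*, Compositio Math. 39 (1979), §4 pp. 22–25.
* [Bouaziz1994IntegralesOrbitales] A. Bouaziz, *Intégrales orbitales sur les algèbres de Lie réductives*, Invent. Math. 115 (1994), §3.1 (I₁) p. 579, §3.2 p. 580.
-/

set_option autoImplicit false

noncomputable section

open MeasureTheory MeasureTheory.Measure NumberField NumberField.InfinitePlace NumberField.mixedEmbedding Matrix Complex Set Filter Topology
open scoped MatrixGroups Matrix Real Classical ENNReal NNReal ContDiff Matrix.Norms.Operator Pointwise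
open Literature.NumberTheory.Automorphic Literature.NumberTheory.Automorphic.UnitaryGroup Literature.NumberTheory.Automorphic.ArchCartan
open Literature.NumberTheory.GaloisRepresentations Literature.MeasureTheory.Group Literature.LinearAlgebra.Matrix

namespace Literature.NumberTheory.Rogawski1990

/-! ## §1 (H-cont)^E: the corner model is continuous off the corner walls -/

section Cont

variable (L : Type) [Field L] [NumberField L] (E : Finset {w : InfinitePlace L // IsComplex w})

/-- **THE CORNER MODEL IS CONTINUOUS OFF THE CORNER WALLS**: for `f : (coordinates) × M₂(ℂ)^E → F` jointly continuous and vanishing off one compact set of matrix tuples, and any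
measure `μ₀` finite on compacts on `U(J)(ℂ)`, `c ↦ ∫ f(c, (↑↑(h_w T(c_w) h_w⁻¹))_{w ∈ E}) dμ₀^{⊗E}(h)` is continuous on `{c | ∀ w ∈ E, e^{i c_{w0}} ≠ e^{i c_{w2}}}` (Mathlib
`continuousOn_integral_of_compact_support` on a ball around each point; the uniform compact `h`-support there is the product of the one-place compacta ★
`isCompact_setOf_exists_conj_cayleyTorus_mem`). [cite: Rogawski1990, §8.2 p. 122] [cite: Varadarajan1977, I §1.12] -/
theorem continuousOn_integral_conj_cayleyTorus_pi {J : Matrix (Fin 2) (Fin 2) ℂ} (hJ : J = (StdForm.antidiagonal 2).over ℂ)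
    [MeasurableSpace ↥(unitaryGroupOfForm (starRingEnd ℂ) J)] [BorelSpace ↥(unitaryGroupOfForm (starRingEnd ℂ) J)]
    [SecondCountableTopology ↥(unitaryGroupOfForm (starRingEnd ℂ) J)]
    (μ₀ : Measure ↥(unitaryGroupOfForm (starRingEnd ℂ) J)) [IsFiniteMeasureOnCompacts μ₀] [SigmaFinite μ₀]
    {F : Type*} [NormedAddCommGroup F] [NormedSpace ℝ F]
    (f : ({w : InfinitePlace L // IsComplex w} → Fin 3 → ℝ) × (↥E → Matrix (Fin 2) (Fin 2) ℂ) → F) (hf : Continuous f)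
    (hfC : ∃ C : Set (↥E → Matrix (Fin 2) (Fin 2) ℂ), IsCompact C ∧ ∀ c X, X ∉ C → f (c, X) = 0) :
    ContinuousOn (fun c : {w : InfinitePlace L // IsComplex w} → Fin 3 → ℝ =>
        ∫ h : ↥E → ↥(unitaryGroupOfForm (starRingEnd ℂ) J),
          f (c, fun w => (((h w * ⟨Matrix.GeneralLinearGroup.mkOfDetNeZero !![(1 : ℂ), 1; 1, -1] det_cayleyTwo_ne_zero *
                circleDiagonal 2 ![Circle.exp (c w.1 0), Circle.exp (c w.1 2)] *
                (Matrix.GeneralLinearGroup.mkOfDetNeZero !![(1 : ℂ), 1; 1, -1] det_cayleyTwo_ne_zero)⁻¹,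
              cayley_conj_circleDiagonal_mem_of_eq_over hJ _⟩ * (h w)⁻¹ : ↥(unitaryGroupOfForm (starRingEnd ℂ) J)) : GL (Fin 2) ℂ) : Matrix (Fin 2) (Fin 2) ℂ))
          ∂(Measure.pi fun _ => μ₀))
      {c | ∀ w ∈ E, Circle.exp (c w 0) ≠ Circle.exp (c w 2)} := by
  obtain ⟨C, hC, hfC⟩ := hfC
  have hO : IsOpen {c : {w : InfinitePlace L // IsComplex w} → Fin 3 → ℝ | ∀ w ∈ E, Circle.exp (c w 0) ≠ Circle.exp (c w 2)} := by
    have h : {c : {w : InfinitePlace L // IsComplex w} → Fin 3 → ℝ | ∀ w ∈ E, Circle.exp (c w 0) ≠ Circle.exp (c w 2)} =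
        ⋂ w ∈ E, {c | Circle.exp (c w 0) ≠ Circle.exp (c w 2)} := by ext c; simp
    rw [h]
    exact isOpen_biInter_finset fun w _ => isOpen_ne_fun (continuous_circleExp_coord w 0) (continuous_circleExp_coord w 2)
  have hce := isClosedEmbedding_coe_unitaryGroupOfForm_of_eq_over hJ
  have hT : ∀ w : ↥E, Continuous fun c : {w : InfinitePlace L // IsComplex w} → Fin 3 → ℝ =>
      (⟨Matrix.GeneralLinearGroup.mkOfDetNeZero !![(1 : ℂ), 1; 1, -1] det_cayleyTwo_ne_zero * circleDiagonal 2 ![Circle.exp (c w.1 0), Circle.exp (c w.1 2)] *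
          (Matrix.GeneralLinearGroup.mkOfDetNeZero !![(1 : ℂ), 1; 1, -1] det_cayleyTwo_ne_zero)⁻¹,
        cayley_conj_circleDiagonal_mem_of_eq_over hJ _⟩ : ↥(unitaryGroupOfForm (starRingEnd ℂ) J)) := fun w => continuous_cayleyTorus L w.1 hJ
  -- the integrand is jointly continuous in `(c, h)`
  have hFc : Continuous fun p : ({w : InfinitePlace L // IsComplex w} → Fin 3 → ℝ) × (↥E → ↥(unitaryGroupOfForm (starRingEnd ℂ) J)) =>
      f (p.1, fun w => (((p.2 w * ⟨Matrix.GeneralLinearGroup.mkOfDetNeZero !![(1 : ℂ), 1; 1, -1] det_cayleyTwo_ne_zero *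
            circleDiagonal 2 ![Circle.exp (p.1 w.1 0), Circle.exp (p.1 w.1 2)] *
            (Matrix.GeneralLinearGroup.mkOfDetNeZero !![(1 : ℂ), 1; 1, -1] det_cayleyTwo_ne_zero)⁻¹,
          cayley_conj_circleDiagonal_mem_of_eq_over hJ _⟩ * (p.2 w)⁻¹ : ↥(unitaryGroupOfForm (starRingEnd ℂ) J)) : GL (Fin 2) ℂ) : Matrix (Fin 2) (Fin 2) ℂ)) :=
    hf.comp (continuous_fst.prodMk (continuous_pi fun w =>
      hce.continuous.comp ((((continuous_apply w).comp continuous_snd).mul ((hT w).comp continuous_fst)).mul ((continuous_apply w).comp continuous_snd).inv)))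
  intro c₀ hc₀
  obtain ⟨r, hr, hball⟩ := Metric.isOpen_iff.1 hO c₀ hc₀
  have hN : IsCompact (Metric.closedBall c₀ (r / 2)) := isCompact_closedBall c₀ (r / 2)
  have hNreg : ∀ w ∈ E, ∀ c ∈ Metric.closedBall c₀ (r / 2), Circle.exp (c w 0) ≠ Circle.exp (c w 2) :=
    fun w hw c hc => hball (Metric.closedBall_subset_ball (by linarith) hc) w hw
  -- the uniform compact `h`-support over the ball: the product of the one-place compacta
  have hk : IsCompact (Set.univ.pi fun w : ↥E => {y : ↥(unitaryGroupOfForm (starRingEnd ℂ) J) | ∃ c ∈ Metric.closedBall c₀ (r / 2),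
      (((y * ⟨Matrix.GeneralLinearGroup.mkOfDetNeZero !![(1 : ℂ), 1; 1, -1] det_cayleyTwo_ne_zero *
            circleDiagonal 2 ![Circle.exp (c w.1 0), Circle.exp (c w.1 2)] *
            (Matrix.GeneralLinearGroup.mkOfDetNeZero !![(1 : ℂ), 1; 1, -1] det_cayleyTwo_ne_zero)⁻¹,
          cayley_conj_circleDiagonal_mem_of_eq_over hJ _⟩ * y⁻¹ : ↥(unitaryGroupOfForm (starRingEnd ℂ) J)) : GL (Fin 2) ℂ) : Matrix (Fin 2) (Fin 2) ℂ) ∈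
        (fun X : ↥E → Matrix (Fin 2) (Fin 2) ℂ => X w) '' C}) :=
    isCompact_univ_pi fun w => isCompact_setOf_exists_conj_cayleyTorus_mem L w.1 hJ hN (hNreg w.1 w.2) (hC.image (continuous_apply w))
  have hloc : ContinuousOn (fun c : {w : InfinitePlace L // IsComplex w} → Fin 3 → ℝ =>
        ∫ h : ↥E → ↥(unitaryGroupOfForm (starRingEnd ℂ) J),
          f (c, fun w => (((h w * ⟨Matrix.GeneralLinearGroup.mkOfDetNeZero !![(1 : ℂ), 1; 1, -1] det_cayleyTwo_ne_zero *
                circleDiagonal 2 ![Circle.exp (c w.1 0), Circle.exp (c w.1 2)] *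
                (Matrix.GeneralLinearGroup.mkOfDetNeZero !![(1 : ℂ), 1; 1, -1] det_cayleyTwo_ne_zero)⁻¹,
              cayley_conj_circleDiagonal_mem_of_eq_over hJ _⟩ * (h w)⁻¹ : ↥(unitaryGroupOfForm (starRingEnd ℂ) J)) : GL (Fin 2) ℂ) : Matrix (Fin 2) (Fin 2) ℂ))
          ∂(Measure.pi fun _ => μ₀))
      (Metric.ball c₀ (r / 2)) := by
    refine continuousOn_integral_of_compact_support hk hFc.continuousOn ?_
    intro c h hc hh
    apply hfC
    intro hmem
    refine hh (Set.mem_univ_pi.2 fun w => ⟨c, Metric.ball_subset_closedBall hc, ⟨_, hmem, rfl⟩⟩)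
  exact (hloc.continuousAt (Metric.ball_mem_nhds c₀ (half_pos hr))).continuousWithinAt

omit [NumberField L] in
/-- The corner root factors `Π_{w ∈ E} (1 − e^{i(c_{w1}−c_{w0})})(1 − e^{i(c_{w2}−c_{w0})})(1 − e^{i(c_{w2}−c_{w1})})` depend continuously on `c`. [cite: Rogawski1990, §8.2 p. 118] -/
theorem continuous_cornerRootFactors :
    Continuous fun c : {w : InfinitePlace L // IsComplex w} → Fin 3 → ℝ =>
      ∏ w ∈ E, ((1 - (Circle.exp (c w 1 - c w 0) : ℂ)) * (1 - (Circle.exp (c w 2 - c w 0) : ℂ)) * (1 - (Circle.exp (c w 2 - c w 1) : ℂ))) :=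
  continuous_finsetProd _ fun w _ => continuous_wallRootFactors L w

/-- **(H-cont)^E — THE CORNER BOX MODEL IS CONTINUOUS OFF THE CORNER WALLS**: for `f` jointly smooth (continuity is what is used) and vanishing off one compact set of matrix
tuples, `c ↦ Φ_E(c) · (K · ∫_{U(J)^E} f(c, (↑↑(h_w T(c_w) h_w⁻¹))_w) dμ₀^{⊗E})` is continuous on `U ∩ {∀ w ∈ E, e^{ic_{w0}} ≠ e^{ic_{w2}}}` for every `U` and every constant `K`.
[cite: Rogawski1990, §8.2 p. 122] [cite: Varadarajan1977, I §1.12] -/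
theorem continuousOn_cornerBoxModel {J : Matrix (Fin 2) (Fin 2) ℂ} (hJ : J = (StdForm.antidiagonal 2).over ℂ)
    [MeasurableSpace ↥(unitaryGroupOfForm (starRingEnd ℂ) J)] [BorelSpace ↥(unitaryGroupOfForm (starRingEnd ℂ) J)]
    [SecondCountableTopology ↥(unitaryGroupOfForm (starRingEnd ℂ) J)]
    (μ₀ : Measure ↥(unitaryGroupOfForm (starRingEnd ℂ) J)) [IsFiniteMeasureOnCompacts μ₀] [SigmaFinite μ₀]
    (U : Set ({w : InfinitePlace L // IsComplex w} → Fin 3 → ℝ))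
    (f : ({w : InfinitePlace L // IsComplex w} → Fin 3 → ℝ) × (↥E → Matrix (Fin 2) (Fin 2) ℂ) → ℂ) (hf : ContDiff ℝ ∞ f)
    (hfC : ∃ C : Set (↥E → Matrix (Fin 2) (Fin 2) ℂ), IsCompact C ∧ ∀ c X, X ∉ C → f (c, X) = 0) (K : ℂ) :
    ContinuousOn (fun c : {w : InfinitePlace L // IsComplex w} → Fin 3 → ℝ =>
        (∏ w ∈ E, ((1 - (Circle.exp (c w 1 - c w 0) : ℂ)) * (1 - (Circle.exp (c w 2 - c w 0) : ℂ)) * (1 - (Circle.exp (c w 2 - c w 1) : ℂ)))) *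
        (K * ∫ h : ↥E → ↥(unitaryGroupOfForm (starRingEnd ℂ) J),
          f (c, fun w => (((h w * ⟨Matrix.GeneralLinearGroup.mkOfDetNeZero !![(1 : ℂ), 1; 1, -1] det_cayleyTwo_ne_zero *
                circleDiagonal 2 ![Circle.exp (c w.1 0), Circle.exp (c w.1 2)] *
                (Matrix.GeneralLinearGroup.mkOfDetNeZero !![(1 : ℂ), 1; 1, -1] det_cayleyTwo_ne_zero)⁻¹,
              cayley_conj_circleDiagonal_mem_of_eq_over hJ _⟩ * (h w)⁻¹ : ↥(unitaryGroupOfForm (starRingEnd ℂ) J)) : GL (Fin 2) ℂ) : Matrix (Fin 2) (Fin 2) ℂ))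
          ∂(Measure.pi fun _ => μ₀)))
      (U ∩ {c | ∀ w ∈ E, Circle.exp (c w 0) ≠ Circle.exp (c w 2)}) :=
  ((continuous_cornerRootFactors L E).continuousOn.mul
    (continuousOn_const.mul ((continuousOn_integral_conj_cayleyTorus_pi L E hJ μ₀ f hf.continuous hfC).mono inter_subset_right)))

end Cont

/-! ## §2 The dock at corners: `U ∩ RegG S → U ∩ InRegG` -/

section Assembly

variable (L : Type) [Field L] [NumberField L] [IsCMField L] (α : Fin 3 → L)
  [MeasurableSpace ↥(arch (↥(maximalRealSubfield L)) L (IsCMField.complexConj L) 3 (Matrix.diagonal α))]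
  [BorelSpace ↥(arch (↥(maximalRealSubfield L)) L (IsCMField.complexConj L) 3 (Matrix.diagonal α))]
  (ν' : Measure ↥(arch (↥(maximalRealSubfield L)) L (IsCMField.complexConj L) 3 (Matrix.diagonal α))) [ν'.IsHaarMeasure] [ν'.IsMulRightInvariant]

/-- **THE DOCK AT CORNERS.**  If, on an open box `U ∋ x` whose only noncompact walls are the corner walls at the places of `E` (clause 7), the RAW member `orbFamG L α ν′ a′ S`
satisfies the corner descent identity `orbFamG … S c = Φ_E(c) · K · ∫_{U(J)^E} f(c, (h_w T(c_w) h_w⁻¹)_w) dμ₀^{⊗E}` at every `G`-REGULAR `c ∈ U`, then the EXTENDED family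
`orbFamGExt … S` satisfies it at EVERY `c ∈ U` off the corner walls: ★ `hcExtendG_eqOn_of_continuousOn` with §1's continuity of the model.
[cite: Varadarajan1977, I §1.12] [cite: Bouaziz1994IntegralesOrbitales, §3.1 (I₁)–(I₂) p. 579] [cite: Shelstad1979, §4 Lemma 4.3 (p. 25)] -/
theorem exists_descent_box_orbFamGExt_inRegG_corners_of_core
    {J : Matrix (Fin 2) (Fin 2) ℂ} (hJ : J = (StdForm.antidiagonal 2).over ℂ)
    [MeasurableSpace ↥(unitaryGroupOfForm (starRingEnd ℂ) J)] [BorelSpace ↥(unitaryGroupOfForm (starRingEnd ℂ) J)]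
    [SecondCountableTopology ↥(unitaryGroupOfForm (starRingEnd ℂ) J)]
    (μ₀ : Measure ↥(unitaryGroupOfForm (starRingEnd ℂ) J)) [IsFiniteMeasureOnCompacts μ₀] [SigmaFinite μ₀]
    {S E : Finset {w : InfinitePlace L // IsComplex w}} {x : {w : InfinitePlace L // IsComplex w} → Fin 3 → ℝ}
    {a' : ↥(arch (↥(maximalRealSubfield L)) L (IsCMField.complexConj L) 3 (Matrix.diagonal α)) → ℂ}
    {K : ℂ} {U : Set ({w : InfinitePlace L // IsComplex w} → Fin 3 → ℝ)}
    {f : ({w : InfinitePlace L // IsComplex w} → Fin 3 → ℝ) × (↥E → Matrix (Fin 2) (Fin 2) ℂ) → ℂ}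
    (hK : K ≠ 0) (hUo : IsOpen U) (hxU : x ∈ U) (hf : ContDiff ℝ ∞ f)
    (hfC : ∃ C : Set (↥E → Matrix (Fin 2) (Fin 2) ℂ), IsCompact C ∧ ∀ c X, X ∉ C → f (c, X) = 0)
    (hft : ∀ c c' X, (∀ w, w ∉ E → c w = c' w) → (∀ w, w ∈ E → c w 1 = c' w 1) → f (c, X) = f (c', X))
    (hU7 : ∀ c ∈ U, (∀ w ∈ E, Circle.exp (c w 0) ≠ Circle.exp (c w 2)) → c ∈ InRegG (slotSign L α) S)
    (hcore : ∀ c ∈ U, c ∈ RegG S →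
        orbFamG L α ν' a' S c =
          (∏ w ∈ E, ((1 - (Circle.exp (c w 1 - c w 0) : ℂ)) * (1 - (Circle.exp (c w 2 - c w 0) : ℂ)) * (1 - (Circle.exp (c w 2 - c w 1) : ℂ)))) *
          (K * ∫ h : ↥E → ↥(unitaryGroupOfForm (starRingEnd ℂ) J),
            f (c, fun w => (((h w * ⟨Matrix.GeneralLinearGroup.mkOfDetNeZero !![(1 : ℂ), 1; 1, -1] det_cayleyTwo_ne_zero *
                  circleDiagonal 2 ![Circle.exp (c w.1 0), Circle.exp (c w.1 2)] *
                  (Matrix.GeneralLinearGroup.mkOfDetNeZero !![(1 : ℂ), 1; 1, -1] det_cayleyTwo_ne_zero)⁻¹,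
                cayley_conj_circleDiagonal_mem_of_eq_over hJ _⟩ * (h w)⁻¹ : ↥(unitaryGroupOfForm (starRingEnd ℂ) J)) : GL (Fin 2) ℂ) : Matrix (Fin 2) (Fin 2) ℂ))
            ∂(Measure.pi fun _ => μ₀))) :
    ∃ (K : ℂ) (U : Set ({w : InfinitePlace L // IsComplex w} → Fin 3 → ℝ)) (f : ({w : InfinitePlace L // IsComplex w} → Fin 3 → ℝ) × (↥E → Matrix (Fin 2) (Fin 2) ℂ) → ℂ),
      K ≠ 0 ∧ IsOpen U ∧ x ∈ U ∧ ContDiff ℝ ∞ f ∧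
      (∃ C : Set (↥E → Matrix (Fin 2) (Fin 2) ℂ), IsCompact C ∧ ∀ c X, X ∉ C → f (c, X) = 0) ∧
      (∀ c c' X, (∀ w, w ∉ E → c w = c' w) → (∀ w, w ∈ E → c w 1 = c' w 1) → f (c, X) = f (c', X)) ∧
      (∀ c ∈ U, (∀ w ∈ E, Circle.exp (c w 0) ≠ Circle.exp (c w 2)) → c ∈ InRegG (slotSign L α) S) ∧
      ∀ c ∈ U, (∀ w ∈ E, Circle.exp (c w 0) ≠ Circle.exp (c w 2)) →
        orbFamGExt L α ν' a' S c =
          (∏ w ∈ E, ((1 - (Circle.exp (c w 1 - c w 0) : ℂ)) * (1 - (Circle.exp (c w 2 - c w 0) : ℂ)) * (1 - (Circle.exp (c w 2 - c w 1) : ℂ)))) *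
          (K * ∫ h : ↥E → ↥(unitaryGroupOfForm (starRingEnd ℂ) J),
            f (c, fun w => (((h w * ⟨Matrix.GeneralLinearGroup.mkOfDetNeZero !![(1 : ℂ), 1; 1, -1] det_cayleyTwo_ne_zero *
                  circleDiagonal 2 ![Circle.exp (c w.1 0), Circle.exp (c w.1 2)] *
                  (Matrix.GeneralLinearGroup.mkOfDetNeZero !![(1 : ℂ), 1; 1, -1] det_cayleyTwo_ne_zero)⁻¹,
                cayley_conj_circleDiagonal_mem_of_eq_over hJ _⟩ * (h w)⁻¹ : ↥(unitaryGroupOfForm (starRingEnd ℂ) J)) : GL (Fin 2) ℂ) : Matrix (Fin 2) (Fin 2) ℂ))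
            ∂(Measure.pi fun _ => μ₀)) := by
  have hWo : IsOpen {c : {w : InfinitePlace L // IsComplex w} → Fin 3 → ℝ | ∀ w ∈ E, Circle.exp (c w 0) ≠ Circle.exp (c w 2)} := by
    have h : {c : {w : InfinitePlace L // IsComplex w} → Fin 3 → ℝ | ∀ w ∈ E, Circle.exp (c w 0) ≠ Circle.exp (c w 2)} =
        ⋂ w ∈ E, {c | Circle.exp (c w 0) ≠ Circle.exp (c w 2)} := by ext c; simp
    rw [h]
    exact isOpen_biInter_finset fun w _ => isOpen_ne_fun (continuous_circleExp_coord w 0) (continuous_circleExp_coord w 2)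
  have hVo : IsOpen (U ∩ {c : {w : InfinitePlace L // IsComplex w} → Fin 3 → ℝ | ∀ w ∈ E, Circle.exp (c w 0) ≠ Circle.exp (c w 2)}) := hUo.inter hWo
  have hcont := continuousOn_cornerBoxModel L E hJ μ₀ U f hf hfC K
  have hglue := hcExtendG_eqOn_of_continuousOn (slotSign L α) S (orbFamG L α ν' a' S) hVo hcont (fun c hc => hcore c hc.1.1 hc.2)
  refine ⟨K, U, f, hK, hUo, hxU, hf, hfC, hft, hU7, fun c hcU hcw => ?_⟩
  have hcin : c ∈ InRegG (slotSign L α) S := hU7 c hcU hcw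
  have h := hglue ⟨⟨hcU, hcw⟩, hcin⟩
  rw [orbFamGExt_apply]
  exact h

end Assembly

/-! ## §3 The core package at corners on `U ∩ RegG` (L2^E ∘ held-out family ∘ cut-off ∘ L1^ι) and §4 the head -/

section Core

variable (L : Type) [Field L] [NumberField L] [IsCMField L] (α : Fin 3 → L)
  [MeasurableSpace ↥(arch (↥(maximalRealSubfield L)) L (IsCMField.complexConj L) 3 (Matrix.diagonal α))]
  [BorelSpace ↥(arch (↥(maximalRealSubfield L)) L (IsCMField.complexConj L) 3 (Matrix.diagonal α))]
  (ν' : Measure ↥(arch (↥(maximalRealSubfield L)) L (IsCMField.complexConj L) 3 (Matrix.diagonal α))) [ν'.IsHaarMeasure] [ν'.IsMulRightInvariant]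

set_option maxHeartbeats 1600000 in
/-- **(X-core) CORE PACKAGE AT CORNERS, on `U ∩ RegG S`.**  Frame: diagonal anisotropic `α` with real weights at every place; split label `S` (admissible); a finite set `E` of
compact-chart places (`E ∩ S = ∅`, each in `splitChartPlaces`); base point `x` with a `(0,2)`-corner at every `w ∈ E` (`x_w 0 = x_w 2`, `e^{i x_w 1} ≠ e^{i x_w 0}`) and
in-regular at every other compact place; the split coordinates ARBITRARY (real walls allowed).  Conclusion: `K ≠ 0`, an open `U ∋ x`, ONE jointly smooth `f` compactly
supported in the matrix variables and depending on `c` only through the non-corner coordinates and the middle corner coordinates `c_w 1`, `w ∈ E`, with clause 7 (off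
the corner walls `U ⊆ InRegG`) and, at every `G`-regular `c ∈ U`,
`orbFamG … S c = Φ_E(c) · K · ∫_{U(J)^E} f(c, (↑↑(h_w · P diag(e^{ic_{w0}}, e^{ic_{w2}}) P⁻¹ · h_w⁻¹))_w) dμ₀^{⊗E}(h)`.
Road: L2^E (A5a″)^E «`E` held out, split places unfolded» ∘ the held-out family (★ (A4′)) ∘ a smooth cut-off in the spectator coordinates ∘ ★ L1^ι at `ι := ιE`.
[cite: Rogawski1990, §4.12 Lemma 4.12.1 p. 61; §8.2 pp. 119–124] [cite: Shelstad1979, §4 pp. 22–25] [cite: Bouaziz1994IntegralesOrbitales, §3.1 (I₁) p. 579; §3.2 p. 580] -/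
theorem exists_descent_box_orbFamG_cornerPackage (hα : ∀ i, α i ≠ 0)
    (hreal : ∀ (w : {w : InfinitePlace L // IsComplex w}) (i : Fin 3), (w.1.embedding (α i)).im = 0)
    {J : Matrix (Fin 2) (Fin 2) ℂ} (hJ : J = (StdForm.antidiagonal 2).over ℂ)
    [MeasurableSpace ↥(unitaryGroupOfForm (starRingEnd ℂ) J)] [BorelSpace ↥(unitaryGroupOfForm (starRingEnd ℂ) J)]
    [LocallyCompactSpace ↥(unitaryGroupOfForm (starRingEnd ℂ) J)] [SecondCountableTopology ↥(unitaryGroupOfForm (starRingEnd ℂ) J)]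
    (μ₀ : Measure ↥(unitaryGroupOfForm (starRingEnd ℂ) J)) [μ₀.IsHaarMeasure] [μ₀.IsMulRightInvariant]
    {S E : Finset {w : InfinitePlace L // IsComplex w}} {x : {w : InfinitePlace L // IsComplex w} → Fin 3 → ℝ}
    (hS : ∀ w, w ∈ S → w ∈ splitChartPlaces L α) (hE : ∀ w, w ∈ E → w ∉ S) (hEsp : ∀ w, w ∈ E → w ∈ splitChartPlaces L α)
    (hx02 : ∀ w, w ∈ E → x w 0 = x w 2) (hx1 : ∀ w, w ∈ E → Circle.exp (x w 1) ≠ Circle.exp (x w 0))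
    (hxin : ∀ w, w ∉ S → w ∉ E → ∀ i j : Fin 3, i ≠ j → slotSign L α w i ≠ slotSign L α w j → Circle.exp (x w i) ≠ Circle.exp (x w j))
    {a' : ↥(arch (↥(maximalRealSubfield L)) L (IsCMField.complexConj L) 3 (Matrix.diagonal α)) → ℂ} (ha' : ArchSmooth L 3 (Matrix.diagonal α) a') :
    ∃ (K : ℂ) (U : Set ({w : InfinitePlace L // IsComplex w} → Fin 3 → ℝ)) (f : ({w : InfinitePlace L // IsComplex w} → Fin 3 → ℝ) × (↥E → Matrix (Fin 2) (Fin 2) ℂ) → ℂ),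
      K ≠ 0 ∧ IsOpen U ∧ x ∈ U ∧ ContDiff ℝ ∞ f ∧
      (∃ C : Set (↥E → Matrix (Fin 2) (Fin 2) ℂ), IsCompact C ∧ ∀ c X, X ∉ C → f (c, X) = 0) ∧
      (∀ c c' X, (∀ w, w ∉ E → c w = c' w) → (∀ w, w ∈ E → c w 1 = c' w 1) → f (c, X) = f (c', X)) ∧
      (∀ c ∈ U, (∀ w ∈ E, Circle.exp (c w 0) ≠ Circle.exp (c w 2)) → c ∈ InRegG (slotSign L α) S) ∧
      ∀ c ∈ U, c ∈ RegG S →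
        orbFamG L α ν' a' S c =
          (∏ w ∈ E, ((1 - (Circle.exp (c w 1 - c w 0) : ℂ)) * (1 - (Circle.exp (c w 2 - c w 0) : ℂ)) * (1 - (Circle.exp (c w 2 - c w 1) : ℂ)))) *
          (K * ∫ h : ↥E → ↥(unitaryGroupOfForm (starRingEnd ℂ) J),
            f (c, fun w => (((h w * ⟨Matrix.GeneralLinearGroup.mkOfDetNeZero !![(1 : ℂ), 1; 1, -1] det_cayleyTwo_ne_zero *
                  circleDiagonal 2 ![Circle.exp (c w.1 0), Circle.exp (c w.1 2)] *
                  (Matrix.GeneralLinearGroup.mkOfDetNeZero !![(1 : ℂ), 1; 1, -1] det_cayleyTwo_ne_zero)⁻¹,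
                cayley_conj_circleDiagonal_mem_of_eq_over hJ _⟩ * (h w)⁻¹ : ↥(unitaryGroupOfForm (starRingEnd ℂ) J)) : GL (Fin 2) ℂ) : Matrix (Fin 2) (Fin 2) ℂ))
            ∂(Measure.pi fun _ => μ₀)) := by
  /- (0) Borel structures and topological facts on the local groups and the quotients -/
  letI : ∀ w : {w : InfinitePlace L // IsComplex w}, MeasurableSpace ↥(archLocal L 3 (Matrix.diagonal α) w) := fun w => borel _
  haveI : ∀ w : {w : InfinitePlace L // IsComplex w}, BorelSpace ↥(archLocal L 3 (Matrix.diagonal α) w) := fun w => ⟨rfl⟩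
  haveI : ∀ w : {w : InfinitePlace L // IsComplex w}, LocallyCompactSpace ↥(archLocal L 3 (Matrix.diagonal α) w) := fun w => locallyCompactSpace_archLocal_three L α w
  haveI : ∀ w : {w : InfinitePlace L // IsComplex w}, SecondCountableTopology ↥(archLocal L 3 (Matrix.diagonal α) w) := fun w => secondCountableTopology_archLocal_three L α w
  letI : ∀ w : {w : InfinitePlace L // IsComplex w}, MeasurableSpace (↥(archLocal L 3 (Matrix.diagonal α) w) ⧸ chartTorusGLoc L α w S) := fun w => borel _
  haveI : ∀ w : {w : InfinitePlace L // IsComplex w}, BorelSpace (↥(archLocal L 3 (Matrix.diagonal α) w) ⧸ chartTorusGLoc L α w S) := fun w => ⟨rfl⟩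
  letI : MeasurableSpace ((∀ w : {w : {w : {w : InfinitePlace L // IsComplex w} // w ∉ S} // w.1 ∉ E}, ↥(archLocal L 3 (Matrix.diagonal α) w.1.1)) ⧸ Subgroup.pi Set.univ (fun w : {w : {w : {w : InfinitePlace L // IsComplex w} // w ∉ S} // w.1 ∉ E} => chartTorusGLoc L α w.1.1 S)) := borel _
  haveI : BorelSpace ((∀ w : {w : {w : {w : InfinitePlace L // IsComplex w} // w ∉ S} // w.1 ∉ E}, ↥(archLocal L 3 (Matrix.diagonal α) w.1.1)) ⧸ Subgroup.pi Set.univ (fun w : {w : {w : {w : InfinitePlace L // IsComplex w} // w ∉ S} // w.1 ∉ E} => chartTorusGLoc L α w.1.1 S)) := ⟨rfl⟩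
  /- (1) the product reading of `ν′`; unimodularity of the local factors -/
  obtain ⟨ν'w, hν'w, hν⟩ := exists_isHaarMeasure_eq_map_archPiEquivCM_symm_pi L 3 α ν'
  haveI : ∀ w, (ν'w w).IsHaarMeasure := hν'w
  haveI : ∀ w, (ν'w w).IsMulRightInvariant := fun w => isMulRightInvariant_of_isHaarMeasure_archLocal_diagonal_of_im_eq_zero L α hα w (hreal w) (ν'w w)
  /- (2) torus Haar measures -/
  haveI : ∀ w : {w : InfinitePlace L // IsComplex w}, (chartHaarGLoc L α w S).IsHaarMeasure := fun w => isHaarMeasure_chartHaarGLoc L α w S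
  haveI : ∀ w : {w : InfinitePlace L // IsComplex w}, (chartHaarGLoc L α w S).IsInvInvariant := fun w => isInvInvariant_chartHaarGLoc L α w S
  haveI : ∀ w : {w : InfinitePlace L // IsComplex w}, SigmaFinite (chartHaarGLoc L α w S) := fun w => sigmaFinite_chartHaarGLoc L α w S
  obtain ⟨ρrest, hρ1, hρ2, hρ⟩ := exists_haar_map_subgroupPiCoords_eq_pi
    (fun w : {w : {w : {w : InfinitePlace L // IsComplex w} // w ∉ S} // w.1 ∉ E} => chartTorusGLoc L α w.1.1 S) (fun w => isClosed_chartTorusGLoc L α w.1.1 S)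
    (fun w : {w : {w : {w : InfinitePlace L // IsComplex w} // w ∉ S} // w.1 ∉ E} => chartHaarGLoc L α w.1.1 S)
  haveI := hρ1
  haveI := hρ2
  /- (3) the standard split group `U(J₃)(ℂ)` -/
  obtain ⟨J₃, hJ₃⟩ : ∃ J₃ : Matrix (Fin 3) (Fin 3) ℂ, J₃ = (StdForm.antidiagonal 3).over ℂ := ⟨_, rfl⟩
  letI : MeasurableSpace ↥(unitaryGroupOfForm (starRingEnd ℂ) J₃) := borel _
  haveI : BorelSpace ↥(unitaryGroupOfForm (starRingEnd ℂ) J₃) := ⟨rfl⟩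
  letI : MeasurableSpace (↥(unitaryGroupOfForm (starRingEnd ℂ) J₃) ⧸ torusU (starRingEnd ℂ) J₃) := borel _
  haveI : BorelSpace (↥(unitaryGroupOfForm (starRingEnd ℂ) J₃) ⧸ torusU (starRingEnd ℂ) J₃) := ⟨rfl⟩
  haveI : LocallyCompactSpace ↥(unitaryGroupOfForm (starRingEnd ℂ) J₃) := locallyCompactSpace_unitaryGroupOfForm_complex J₃
  haveI : SecondCountableTopology ↥(unitaryGroupOfForm (starRingEnd ℂ) J₃) := secondCountableTopology_unitaryGroupOfForm_complex J₃
  obtain ⟨K, hK, -, hKB⟩ := exists_isCompact_subgroup_unitary_mul_borelU hJ₃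
  haveI : CompactSpace ↥K := isCompact_iff_compactSpace.mp hK
  haveI : LocallyCompactSpace ↥K := hK.isClosed.isClosedEmbedding_subtypeVal.locallyCompactSpace
  obtain ⟨κ, hκ⟩ : ∃ κ : Measure ↥K, κ.IsHaarMeasure := ⟨Measure.haar, inferInstance⟩
  haveI := hκ
  have hN : IsClosed (unipotentU (starRingEnd ℂ) J₃ : Set ↥(unitaryGroupOfForm (starRingEnd ℂ) J₃)) := LineRing.isClosed_unipotentU _ _
  haveI : LocallyCompactSpace ↥(unipotentU (starRingEnd ℂ) J₃) := hN.isClosedEmbedding_subtypeVal.locallyCompactSpace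
  obtain ⟨μN, hμN⟩ : ∃ μN : Measure ↥(unipotentU (starRingEnd ℂ) J₃), μN.IsHaarMeasure := ⟨Measure.haar, inferInstance⟩
  haveI := hμN
  obtain ⟨τ, hτT, hτcoe, hτmul, hτd⟩ := exists_torusU_boostEig_family hJ₃
  /- (4) the frames at the split places and the Iwasawa constants -/
  choose φ hφ hT hφT using fun w : {w : {w : InfinitePlace L // IsComplex w} // w ∈ S} => exists_continuousMulEquiv_archLocal_splitChart_torusU L α w.1 hα (hS _ w.2) hJ₃
  choose T hT using hT
  have hφT' : ∀ (w : {w : {w : InfinitePlace L // IsComplex w} // w ∈ S}) (g : ↥(archLocal L 3 (Matrix.diagonal α) w.1)), (φ w).toMulEquiv g ∈ torusU (starRingEnd ℂ) J₃ ↔ g ∈ chartTorusGLoc L α w.1 S :=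
    fun w g => hφT w S hS w.2 g
  have hφd : ∀ (w : {w : {w : InfinitePlace L // IsComplex w} // w ∈ S}) (cw : Fin 3 → ℝ), glDiagonal 3 ℂ (fun i => Units.mk0 (boostEig cw i) (boostEig_ne_zero cw i)) =
      ((φ w (gprimeBlockAt L α w.1 S cw) : ↥(unitaryGroupOfForm (starRingEnd ℂ) J₃)) : GL (Fin 3) ℂ) := fun w cw => (hφ w S (fun _ => cw) w.2).2.1
  have hC : ∀ w : {w : {w : InfinitePlace L // IsComplex w} // w ∈ S}, ∃ C : ℝ≥0, 0 < C ∧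
      (quotientMeasure (chartTorusGLoc L α w.1 S) (chartHaarGLoc L α w.1 S) (isClosed_chartTorusGLoc L α w.1 S) (ν'w w.1)).map
          (cosetCongr (φ w).toMulEquiv (chartTorusGLoc L α w.1 S) (torusU (starRingEnd ℂ) J₃) (hφT' w)) = C • Measure.map
        (fun p : ↥K × ↥(unipotentU (starRingEnd ℂ) J₃) =>
          (QuotientGroup.mk ((p.1 : ↥(unitaryGroupOfForm (starRingEnd ℂ) J₃)) * (p.2 : ↥(unitaryGroupOfForm (starRingEnd ℂ) J₃))) : ↥(unitaryGroupOfForm (starRingEnd ℂ) J₃) ⧸ torusU (starRingEnd ℂ) J₃))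
        (κ.prod μN) := fun w => by
    haveI := smulInvariantMeasure_quotientMeasure (chartTorusGLoc L α w.1 S) (chartHaarGLoc L α w.1 S) (isClosed_chartTorusGLoc L α w.1 S) (ν'w w.1)
    exact exists_map_cosetCongr_eq_smul_map_of_frame hJ₃ (chartTorusGLoc L α w.1 S) (φ w) (hφT' w) hK hKB κ μN _
      (quotientMeasure_ne_zero (chartTorusGLoc L α w.1 S) (chartHaarGLoc L α w.1 S) (isClosed_chartTorusGLoc L α w.1 S) (ν'w w.1))
  choose C hCpos hμC using hC
  /- (5) L2^E (A5a″)^E: the `E`-quotients outside, unfolded inside — with the inner family named `INNER` -/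
  obtain ⟨INNER, hINNERdef⟩ : ∃ INNER : ({w : InfinitePlace L // IsComplex w} → Fin 3 → ℝ) → (∀ w : {w : {w : {w : InfinitePlace L // IsComplex w} // w ∉ S} // w.1 ∈ E}, ↥(archLocal L 3 (Matrix.diagonal α) w.1.1)) → ℂ,
      INNER = fun c u => ∫ q : ({w : {w : InfinitePlace L // IsComplex w} // w ∈ S} → ↥K × ↥(unipotentU (starRingEnd ℂ) J₃)) × ((∀ w : {w : {w : {w : InfinitePlace L // IsComplex w} // w ∉ S} // w.1 ∉ E}, ↥(archLocal L 3 (Matrix.diagonal α) w.1.1)) ⧸ Subgroup.pi Set.univ (fun w : {w : {w : {w : InfinitePlace L // IsComplex w} // w ∉ S} // w.1 ∉ E} => chartTorusGLoc L α w.1.1 S)),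
            a' ((archPiEquivCM 3 L (Matrix.diagonal α)).symm (fun w =>
              if h : w ∈ S then
                (φ ⟨w, h⟩).symm (((q.1 ⟨w, h⟩).1 : ↥(unitaryGroupOfForm (starRingEnd ℂ) J₃)) *
                  (τ ![0, c w 1, c w 2] * τ ![c w 0 / 2, 0, 0] * ((q.1 ⟨w, h⟩).2 : ↥(unitaryGroupOfForm (starRingEnd ℂ) J₃)) * τ ![c w 0 / 2, 0, 0]) *
                  ((q.1 ⟨w, h⟩).1 : ↥(unitaryGroupOfForm (starRingEnd ℂ) J₃))⁻¹)
              else if hE : w ∈ E then (u ⟨⟨w, h⟩, hE⟩ : ↥(archLocal L 3 (Matrix.diagonal α) w))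
              else
                descConj (fun w : {w : {w : {w : InfinitePlace L // IsComplex w} // w ∉ S} // w.1 ∉ E} => gprimeBlock L α w.1.1 S c)
                  (Subgroup.pi Set.univ (fun w : {w : {w : {w : InfinitePlace L // IsComplex w} // w ∉ S} // w.1 ∉ E} => chartTorusGLoc L α w.1.1 S))
                  (forall_mem_pi_chartTorusGLoc_comm L α S (fun w : {w : {w : {w : InfinitePlace L // IsComplex w} // w ∉ S} // w.1 ∉ E} => w.1.1) c)
                  (fun g => (g ⟨⟨w, h⟩, hE⟩ : ↥(archLocal L 3 (Matrix.diagonal α) w))) q.2))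
            ∂((Measure.pi fun _ : {w : {w : InfinitePlace L // IsComplex w} // w ∈ S} => κ.prod μN).prod
              (quotientMeasure (Subgroup.pi Set.univ (fun w : {w : {w : {w : InfinitePlace L // IsComplex w} // w ∉ S} // w.1 ∉ E} => chartTorusGLoc L α w.1.1 S)) ρrest
                (isClosed_coe_pi _ fun w => isClosed_chartTorusGLoc L α w.1.1 S) (Measure.pi fun w : {w : {w : {w : InfinitePlace L // IsComplex w} // w ∉ S} // w.1 ∉ E} => ν'w w.1.1))) := ⟨_, rfl⟩
  have hA : ∀ c : ({w : InfinitePlace L // IsComplex w} → Fin 3 → ℝ), c ∈ RegG S → orbFamG L α ν' a' S c =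
      (∏ w ∈ Finset.univ.filter (fun w => w ∉ S),
          ((1 - (Circle.exp (c w 1 - c w 0) : ℂ)) * (1 - (Circle.exp (c w 2 - c w 0) : ℂ)) * (1 - (Circle.exp (c w 2 - c w 1) : ℂ)))) *
        (∏ w, ((chartHaarGLoc L α w S (chartBoxImgGLoc L α w S)).toReal : ℂ)) * ((∏ w : {w : {w : InfinitePlace L // IsComplex w} // w ∈ S}, (C w : ℝ) : ℝ) : ℂ) *
        ∫ z : (∀ w : {w : {w : {w : InfinitePlace L // IsComplex w} // w ∉ S} // w.1 ∈ E}, ↥(archLocal L 3 (Matrix.diagonal α) w.1.1) ⧸ chartTorusGLoc L α w.1.1 S),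
          INNER c (fun w => descConj (gprimeBlockAt L α w.1.1 S (c w.1.1)) (chartTorusGLoc L α w.1.1 S) (forall_mem_chartTorusGLoc_comm L α w.1.1 S (c w.1.1)) id (z w))
          ∂(Measure.pi fun w : {w : {w : {w : InfinitePlace L // IsComplex w} // w ∉ S} // w.1 ∈ E} =>
            quotientMeasure (chartTorusGLoc L α w.1.1 S) (chartHaarGLoc L α w.1.1 S) (isClosed_chartTorusGLoc L α w.1.1 S) (ν'w w.1.1)) := by
    intro c hc
    rw [hINNERdef]
    exact orbFamG_eq_integral_unfoldedModel_heldOutFinsetPi_of_regG L α S ν'w ν' hν (fun w => chartHaarGLoc L α w S) E ρrest hρ hJ₃ φ hφT' hφd κ μN hμC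
      τ hτT hτcoe hτmul hτd hα hS ha'.continuous ha'.hasCompactSupport hc
  /- (6) the held-out family in matrix currency (★ §1–§2) -/
  obtain ⟨Ξ, hΞs, ⟨C₀, hC₀, hB0⟩, hBΞ, hΞE⟩ := exists_smooth_heldOut_family_finset L α S hα hreal hS E hE hJ₃ K hK κ μN φ T hT τ hτcoe
    (quotientMeasure (Subgroup.pi Set.univ (fun w : {w : {w : {w : InfinitePlace L // IsComplex w} // w ∉ S} // w.1 ∉ E} => chartTorusGLoc L α w.1.1 S)) ρrest
      (isClosed_coe_pi _ fun w => isClosed_chartTorusGLoc L α w.1.1 S) (Measure.pi fun w : {w : {w : {w : InfinitePlace L // IsComplex w} // w ∉ S} // w.1 ∉ E} => ν'w w.1.1)) ha'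
  have hBΞ' : ∀ (c : ({w : InfinitePlace L // IsComplex w} → Fin 3 → ℝ)) (u : ∀ w : {w : {w : {w : InfinitePlace L // IsComplex w} // w ∉ S} // w.1 ∈ E}, ↥(archLocal L 3 (Matrix.diagonal α) w.1.1)),
      INNER c u = Ξ (c, fun w => ((u w : GL (Fin 3) ℂ) : Matrix (Fin 3) (Fin 3) ℂ)) := fun c u => by
    rw [hINNERdef]; exact hBΞ c u
  have hB0' : ∀ (c : ({w : InfinitePlace L // IsComplex w} → Fin 3 → ℝ)) (u : ∀ w : {w : {w : {w : InfinitePlace L // IsComplex w} // w ∉ S} // w.1 ∈ E}, ↥(archLocal L 3 (Matrix.diagonal α) w.1.1)), u ∉ C₀ → INNER c u = 0 :=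
    fun c u hu => by rw [hINNERdef]; exact hB0 c u hu
  /- (7) the smooth cut-off in the spectator coordinates -/
  obtain ⟨Box, hBoxdef⟩ : ∃ Box : Set ({w : InfinitePlace L // IsComplex w} → Fin 3 → ℝ), Box = {c : ({w : InfinitePlace L // IsComplex w} → Fin 3 → ℝ) | ∀ (i : {w : {w : {w : InfinitePlace L // IsComplex w} // w ∉ S} // w.1 ∉ E}) (a b : Fin 3), a ≠ b →
      slotSign L α i.1.1 a ≠ slotSign L α i.1.1 b → Circle.exp (c i.1.1 a) ≠ Circle.exp (c i.1.1 b)} := ⟨_, rfl⟩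
  have hBoxo : IsOpen Box := by rw [hBoxdef]; exact isOpen_setOf_inRegAt L α (fun w : {w : {w : {w : InfinitePlace L // IsComplex w} // w ∉ S} // w.1 ∉ E} => w.1.1)
  -- the spectator projection: the `E`-coordinates are set to `0`
  obtain ⟨zeroE, hzeroEdef⟩ : ∃ zeroE : ({w : InfinitePlace L // IsComplex w} → Fin 3 → ℝ) → ({w : InfinitePlace L // IsComplex w} → Fin 3 → ℝ),
      zeroE = fun c w => if w ∈ E then 0 else c w := ⟨_, rfl⟩
  have hzeroE_on : ∀ c w, w ∈ E → zeroE c w = 0 := fun c w hw => by rw [hzeroEdef]; exact if_pos hw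
  have hzeroE_off : ∀ c w, w ∉ E → zeroE c w = c w := fun c w hw => by rw [hzeroEdef]; exact if_neg hw
  have hπ₀ : ContDiff ℝ ∞ zeroE := by
    refine contDiff_pi.2 fun w => ?_
    by_cases hw : w ∈ E
    · have h : (fun c : {w : InfinitePlace L // IsComplex w} → Fin 3 → ℝ => zeroE c w) = fun _ => 0 := funext fun c => hzeroE_on c w hw
      rw [h]; exact contDiff_const
    · have h : (fun c : {w : InfinitePlace L // IsComplex w} → Fin 3 → ℝ => zeroE c w) = fun c => c w := funext fun c => hzeroE_off c w hw
      rw [h]; exact contDiff_apply ℝ (Fin 3 → ℝ) w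
  have hzeroE_agree : ∀ c c' : {w : InfinitePlace L // IsComplex w} → Fin 3 → ℝ, (∀ w, w ∉ E → c w = c' w) → zeroE c = zeroE c' := by
    intro c c' h
    funext w
    by_cases hw : w ∈ E
    · rw [hzeroE_on c w hw, hzeroE_on c' w hw]
    · rw [hzeroE_off c w hw, hzeroE_off c' w hw, h w hw]
  have hx₀Box : zeroE x ∈ Box := by
    rw [hBoxdef]
    intro i a b hab hs
    rw [hzeroE_off x i.1.1 i.2]
    exact hxin i.1.1 i.1.2 i.2 a b hab hs
  obtain ⟨ε, hε, hball⟩ := Metric.isOpen_iff.1 hBoxo _ hx₀Box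
  let χ : ContDiffBump (zeroE x) := ⟨ε / 4, ε / 2, by positivity, by linarith⟩
  have hχBox : tsupport (χ : ({w : InfinitePlace L // IsComplex w} → Fin 3 → ℝ) → ℝ) ⊆ Box := by
    rw [χ.tsupport_eq]
    exact (Metric.closedBall_subset_ball (by show ε / 2 < ε; linarith)).trans hball
  obtain ⟨Bt, hBtdef⟩ : ∃ Bt : ({w : InfinitePlace L // IsComplex w} → Fin 3 → ℝ) → (∀ w : {w : {w : {w : InfinitePlace L // IsComplex w} // w ∉ S} // w.1 ∈ E}, ↥(archLocal L 3 (Matrix.diagonal α) w.1.1)) → ℂ,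
      Bt = fun y u => ((χ y : ℝ) : ℂ) * INNER y u := ⟨_, rfl⟩
  obtain ⟨Ξt, hΞtdef⟩ : ∃ Ξt : ({w : InfinitePlace L // IsComplex w} → Fin 3 → ℝ) × ({w : {w : {w : InfinitePlace L // IsComplex w} // w ∉ S} // w.1 ∈ E} → Matrix (Fin 3) (Fin 3) ℂ) → ℂ,
      Ξt = fun q => ((χ q.1 : ℝ) : ℂ) * Ξ q := ⟨_, rfl⟩
  have hΞt : ContDiff ℝ ∞ Ξt := by
    rw [hΞtdef]
    refine contDiff_iff_contDiffAt.2 fun q => ?_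
    by_cases hq : q.1 ∈ Box
    · have hnhds : Box ×ˢ (Set.univ : Set ({w : {w : {w : InfinitePlace L // IsComplex w} // w ∉ S} // w.1 ∈ E} → Matrix (Fin 3) (Fin 3) ℂ)) ∈ 𝓝 q := (hBoxo.prod isOpen_univ).mem_nhds ⟨hq, Set.mem_univ _⟩
      have h1 : ContDiffAt ℝ ∞ Ξ q := by
        have h := hΞs
        rw [hBoxdef] at hq
        exact (h q ⟨hq, Set.mem_univ _⟩).contDiffAt (by rw [hBoxdef] at hnhds; exact hnhds)
      exact ((Complex.ofRealCLM.contDiff.comp (χ.contDiff.comp contDiff_fst)).contDiffAt).mul h1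
    · -- off `tsupport χ` the product vanishes near `q`
      have hq' : q.1 ∉ tsupport (χ : ({w : InfinitePlace L // IsComplex w} → Fin 3 → ℝ) → ℝ) := fun h => hq (hχBox h)
      have h0 : (fun q : ({w : InfinitePlace L // IsComplex w} → Fin 3 → ℝ) × ({w : {w : {w : InfinitePlace L // IsComplex w} // w ∉ S} // w.1 ∈ E} → Matrix (Fin 3) (Fin 3) ℂ) => ((χ q.1 : ℝ) : ℂ) * Ξ q) =ᶠ[𝓝 q]
          fun _ => 0 := by
        have hopen : IsOpen ((Prod.fst : ({w : InfinitePlace L // IsComplex w} → Fin 3 → ℝ) × ({w : {w : {w : InfinitePlace L // IsComplex w} // w ∉ S} // w.1 ∈ E} → Matrix (Fin 3) (Fin 3) ℂ) →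
            ({w : InfinitePlace L // IsComplex w} → Fin 3 → ℝ)) ⁻¹' (tsupport (χ : ({w : InfinitePlace L // IsComplex w} → Fin 3 → ℝ) → ℝ))ᶜ) :=
          (isClosed_tsupport _).isOpen_compl.preimage continuous_fst
        filter_upwards [hopen.mem_nhds hq'] with q' hq''
        rw [image_eq_zero_of_notMem_tsupport hq'', Complex.ofReal_zero, zero_mul]
      exact contDiffAt_const.congr_of_eventuallyEq h0
  have hBtΞt : ∀ (y : ({w : InfinitePlace L // IsComplex w} → Fin 3 → ℝ)) (g : ∀ w : {w : {w : {w : InfinitePlace L // IsComplex w} // w ∉ S} // w.1 ∈ E}, ↥(archLocal L 3 (Matrix.diagonal α) w.1.1)),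
      Bt y g = Ξt (y, fun w => ((g w : GL (Fin 3) ℂ) : Matrix (Fin 3) (Fin 3) ℂ)) := fun y g => by
    rw [hBtdef, hΞtdef]; dsimp only; rw [hBΞ']
  have hBtsupp : ∃ C : Set (∀ w : {w : {w : {w : InfinitePlace L // IsComplex w} // w ∉ S} // w.1 ∈ E}, ↥(archLocal L 3 (Matrix.diagonal α) w.1.1)), IsCompact C ∧
      ∀ y ∈ Metric.ball (zeroE x) χ.rIn, ∀ g ∉ C, Bt y g = 0 :=
    ⟨C₀, hC₀, fun y _ g hg => by rw [hBtdef]; dsimp only; rw [hB0' y g hg, mul_zero]⟩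
  /- (8) L1^ι: the MANY-PLACES PARAMETRIC BLOCK DESCENT at the places of `E` (★ `exists_descent_box_local_param_pi`, `ι := ιE`) -/
  obtain ⟨K₁, V₁, f, hK₁, hV₁o, hxV₁, hf, ⟨Cf, hCf, hfC⟩, hft, hid⟩ :=
    exists_descent_box_local_param_pi L α S ν'w (fun w => chartHaarGLoc L α w S) hα (fun w : {w : {w : {w : InfinitePlace L // IsComplex w} // w ∉ S} // w.1 ∈ E} => w.1.1) (fun w i => hreal w.1.1 i) hJ μ₀
      (fun w => w.1.2) (fun w => hEsp w.1.1 w.2) (x₀ := fun w : {w : {w : {w : InfinitePlace L // IsComplex w} // w ∉ S} // w.1 ∈ E} => x w.1.1) (fun w => hx02 w.1.1 w.2) (fun w => hx1 w.1.1 w.2)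
      (O := Metric.ball (zeroE x) χ.rIn) Bt Ξt hΞt hBtΞt hBtsupp
  /- (9) assembling the package -/
  -- the box `U`
  obtain ⟨Wb, hWbdef⟩ : ∃ Wb : Set ({w : InfinitePlace L // IsComplex w} → Fin 3 → ℝ), Wb =
      {c : ({w : InfinitePlace L // IsComplex w} → Fin 3 → ℝ) | ∀ w ∈ E, Circle.exp (c w 1) ≠ Circle.exp (c w 0) ∧ Circle.exp (c w 1) ≠ Circle.exp (c w 2)} ∩ Box := ⟨_, rfl⟩
  have hWbo : IsOpen Wb := by
    rw [hWbdef]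
    refine IsOpen.inter ?_ hBoxo
    have h : {c : ({w : InfinitePlace L // IsComplex w} → Fin 3 → ℝ) | ∀ w ∈ E, Circle.exp (c w 1) ≠ Circle.exp (c w 0) ∧ Circle.exp (c w 1) ≠ Circle.exp (c w 2)} =
        ⋂ w ∈ E, ({c | Circle.exp (c w 1) ≠ Circle.exp (c w 0)} ∩ {c | Circle.exp (c w 1) ≠ Circle.exp (c w 2)}) := by
      ext c; simp only [Set.mem_setOf_eq, Set.mem_iInter, Set.mem_inter_iff]
    rw [h]
    exact isOpen_biInter_finset fun w _ => (isOpen_ne_fun (continuous_circleExp_coord w 1) (continuous_circleExp_coord w 0)).inter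
      (isOpen_ne_fun (continuous_circleExp_coord w 1) (continuous_circleExp_coord w 2))
  have hxWb : x ∈ Wb := by
    rw [hWbdef]
    refine ⟨fun w hw => ⟨hx1 w hw, fun h => hx1 w hw (h.trans (congrArg Circle.exp (hx02 w hw)).symm)⟩, ?_⟩
    rw [hBoxdef]
    exact fun i a b hab hs => hxin i.1.1 i.1.2 i.2 a b hab hs
  obtain ⟨U, hUdef⟩ : ∃ U : Set ({w : InfinitePlace L // IsComplex w} → Fin 3 → ℝ), U =
      (zeroE ⁻¹' Metric.ball (zeroE x) χ.rIn ∩ (fun c : ({w : InfinitePlace L // IsComplex w} → Fin 3 → ℝ) => fun w : {w : {w : {w : InfinitePlace L // IsComplex w} // w ∉ S} // w.1 ∈ E} => c w.1.1) ⁻¹' V₁) ∩ Wb := ⟨_, rfl⟩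
  have hUo : IsOpen U := by
    rw [hUdef]
    exact ((Metric.isOpen_ball.preimage hπ₀.continuous).inter (hV₁o.preimage (continuous_pi fun w => continuous_apply _))).inter hWbo
  have hxU : x ∈ U := by
    rw [hUdef]
    refine ⟨⟨?_, ?_⟩, hxWb⟩
    · show zeroE x ∈ Metric.ball (zeroE x) χ.rIn
      exact Metric.mem_ball_self χ.rIn_pos
    · show (fun w : {w : {w : {w : InfinitePlace L // IsComplex w} // w ∉ S} // w.1 ∈ E} => x w.1.1) ∈ V₁
      exact hxV₁
  -- the absorbed prefactor: the root factors of the compact places OFF `E`, the torus volumes, the Iwasawa constants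
  have hEsub : E ⊆ Finset.univ.filter (fun w : {w : InfinitePlace L // IsComplex w} => w ∉ S) := fun w hw => Finset.mem_filter.2 ⟨Finset.mem_univ _, hE w hw⟩
  obtain ⟨R', hRdef⟩ : ∃ R' : ({w : InfinitePlace L // IsComplex w} → Fin 3 → ℝ) → ℂ, R' = fun c =>
      (∏ w ∈ (Finset.univ.filter (fun w => w ∉ S)) \ E,
          ((1 - (Circle.exp (c w 1 - c w 0) : ℂ)) * (1 - (Circle.exp (c w 2 - c w 0) : ℂ)) * (1 - (Circle.exp (c w 2 - c w 1) : ℂ)))) *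
        (∏ w, ((chartHaarGLoc L α w S (chartBoxImgGLoc L α w S)).toReal : ℂ)) * ((∏ w : {w : {w : InfinitePlace L // IsComplex w} // w ∈ S}, (C w : ℝ) : ℝ) : ℂ) := ⟨_, rfl⟩
  have hRs : ContDiff ℝ ∞ R' := by
    rw [hRdef]
    refine ((contDiff_prod fun w _ => ?_).mul contDiff_const).mul contDiff_const
    have he : ∀ i j : Fin 3, ContDiff ℝ ∞ fun c : ({w : InfinitePlace L // IsComplex w} → Fin 3 → ℝ) => (Circle.exp (c w j - c w i) : ℂ) := by
      intro i j
      have h : (fun c : ({w : InfinitePlace L // IsComplex w} → Fin 3 → ℝ) => (Circle.exp (c w j - c w i) : ℂ)) = fun c => Complex.exp (((c w j - c w i : ℝ) : ℂ) * I) :=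
        funext fun c => Circle.coe_exp _
      rw [h]
      exact Complex.contDiff_exp.comp ((Complex.ofRealCLM.contDiff.comp ((contDiff_apply_apply ℝ ℝ w j).sub (contDiff_apply_apply ℝ ℝ w i))).mul contDiff_const)
    exact ((contDiff_const.sub (he 0 1)).mul (contDiff_const.sub (he 0 2))).mul (contDiff_const.sub (he 1 2))
  have hRt : ∀ (c c' : ({w : InfinitePlace L // IsComplex w} → Fin 3 → ℝ)), (∀ w, w ∉ E → c w = c' w) → R' c = R' c' := fun c c' hcc' => by
    rw [hRdef]
    dsimp only
    refine congrArg (fun z : ℂ => z * (∏ w, ((chartHaarGLoc L α w S (chartBoxImgGLoc L α w S)).toReal : ℂ)) *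
      ((∏ w : {w : {w : InfinitePlace L // IsComplex w} // w ∈ S}, (C w : ℝ) : ℝ) : ℂ)) ?_
    exact Finset.prod_congr rfl fun w hw => by rw [hcc' w (Finset.mem_sdiff.1 hw).2]
  have hPREF : ∀ c : ({w : InfinitePlace L // IsComplex w} → Fin 3 → ℝ), (∏ w ∈ Finset.univ.filter (fun w => w ∉ S),
          ((1 - (Circle.exp (c w 1 - c w 0) : ℂ)) * (1 - (Circle.exp (c w 2 - c w 0) : ℂ)) * (1 - (Circle.exp (c w 2 - c w 1) : ℂ)))) *
        (∏ w, ((chartHaarGLoc L α w S (chartBoxImgGLoc L α w S)).toReal : ℂ)) * ((∏ w : {w : {w : InfinitePlace L // IsComplex w} // w ∈ S}, (C w : ℝ) : ℝ) : ℂ) =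
      (∏ w ∈ E, ((1 - (Circle.exp (c w 1 - c w 0) : ℂ)) * (1 - (Circle.exp (c w 2 - c w 0) : ℂ)) * (1 - (Circle.exp (c w 2 - c w 1) : ℂ)))) * R' c := by
    intro c
    rw [hRdef]
    dsimp only
    rw [← Finset.prod_sdiff hEsub]
    ring
  -- the reindexing `ιE ≃ ↥E` on the `U(J)`-side (non-dependent `piCongrLeft`, cast-free in the symmetric direction)
  let σ : {w : {w : {w : InfinitePlace L // IsComplex w} // w ∉ S} // w.1 ∈ E} ≃ ↥E :=
    { toFun := fun w => ⟨w.1.1, w.2⟩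
      invFun := fun w => ⟨⟨w.1, hE w.1 w.2⟩, w.2⟩
      left_inv := fun w => rfl
      right_inv := fun w => rfl }
  have hΦU := measurePreserving_piCongrLeft (α := fun _ : ↥E => ↥(unitaryGroupOfForm (starRingEnd ℂ) J)) (μ := fun _ => μ₀) σ
  -- the package
  have hfs : ContDiff ℝ ∞ fun q : ({w : InfinitePlace L // IsComplex w} → Fin 3 → ℝ) × (↥E → Matrix (Fin 2) (Fin 2) ℂ) =>
      R' q.1 * f ((zeroE q.1, fun w : {w : {w : {w : InfinitePlace L // IsComplex w} // w ∉ S} // w.1 ∈ E} => q.1 w.1.1), fun w : {w : {w : {w : InfinitePlace L // IsComplex w} // w ∉ S} // w.1 ∈ E} => q.2 (σ w)) := by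
    have h1 : ContDiff ℝ ∞ fun q : ({w : InfinitePlace L // IsComplex w} → Fin 3 → ℝ) × (↥E → Matrix (Fin 2) (Fin 2) ℂ) =>
        ((zeroE q.1, fun w : {w : {w : {w : InfinitePlace L // IsComplex w} // w ∉ S} // w.1 ∈ E} => q.1 w.1.1), fun w : {w : {w : {w : InfinitePlace L // IsComplex w} // w ∉ S} // w.1 ∈ E} => q.2 (σ w)) :=
      ((hπ₀.comp contDiff_fst).prodMk (contDiff_pi.2 fun w : {w : {w : {w : InfinitePlace L // IsComplex w} // w ∉ S} // w.1 ∈ E} => (contDiff_apply ℝ (Fin 3 → ℝ) w.1.1).comp contDiff_fst)).prodMk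
        (contDiff_pi.2 fun w : {w : {w : {w : InfinitePlace L // IsComplex w} // w ∉ S} // w.1 ∈ E} => (contDiff_apply ℝ (Matrix (Fin 2) (Fin 2) ℂ) (σ w)).comp contDiff_snd)
    exact (hRs.comp contDiff_fst).mul (hf.comp h1)
  refine ⟨K₁, U, fun q => R' q.1 * f ((zeroE q.1, fun w : {w : {w : {w : InfinitePlace L // IsComplex w} // w ∉ S} // w.1 ∈ E} => q.1 w.1.1), fun w : {w : {w : {w : InfinitePlace L // IsComplex w} // w ∉ S} // w.1 ∈ E} => q.2 (σ w)), hK₁, hUo, hxU, hfs,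
    ⟨(fun X : {w : {w : {w : InfinitePlace L // IsComplex w} // w ∉ S} // w.1 ∈ E} → Matrix (Fin 2) (Fin 2) ℂ => fun w : ↥E => X (σ.symm w)) '' Cf,
      hCf.image (continuous_pi fun w => continuous_apply _), fun c X hX => ?_⟩, fun c c' X hcc' hcc'1 => ?_, ?_, ?_⟩
  · -- compact support in the matrix variables
    dsimp only
    rw [hfC _ _ _ fun hmem => hX ⟨_, hmem, funext fun w => rfl⟩, mul_zero]
  · -- tangential clause (agreement off `E` and on the middle corner coordinates)
    dsimp only
    have ht : (fun w : {w : {w : {w : InfinitePlace L // IsComplex w} // w ∉ S} // w.1 ∈ E} => (![0, c w.1.1 1, 0] : Fin 3 → ℝ)) = fun w => ![0, c' w.1.1 1, 0] := funext fun w => by rw [hcc'1 w.1.1 w.2]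
    rw [hRt c c' hcc', hzeroE_agree c c' hcc', hft _ (fun w : {w : {w : {w : InfinitePlace L // IsComplex w} // w ∉ S} // w.1 ∈ E} => c w.1.1), hft _ (fun w : {w : {w : {w : InfinitePlace L // IsComplex w} // w ∉ S} // w.1 ∈ E} => c' w.1.1), ht]
  · -- the box meets `InRegG` off the corner walls
    rintro c hcU hc02
    rw [hUdef] at hcU
    obtain ⟨-, hcW⟩ := hcU
    rw [hWbdef] at hcW
    obtain ⟨hcW1, hcBox⟩ := hcW
    rw [hBoxdef] at hcBox
    intro w hw i j hij hs
    by_cases hwE : w ∈ E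
    · have h1 := hcW1 w hwE
      have h02 := hc02 w hwE
      fin_cases i <;> fin_cases j
      · exact absurd rfl hij
      · exact fun h => h1.1 h.symm
      · exact h02
      · exact h1.1
      · exact absurd rfl hij
      · exact h1.2
      · exact fun h => h02 h.symm
      · exact fun h => h1.2 h.symm
      · exact absurd rfl hij
    · exact hcBox ⟨⟨w, hw⟩, hwE⟩ i j hij hs
  · -- the identity at `G`-regular points of the box
    rintro c hcU hcreg
    rw [hUdef] at hcU
    obtain ⟨⟨hcball, hcV⟩, -⟩ := hcU
    have hoff : ∀ w : {w : {w : {w : InfinitePlace L // IsComplex w} // w ∉ S} // w.1 ∈ E}, Circle.exp (c w.1.1 0) ≠ Circle.exp (c w.1.1 2) := fun w h =>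
      absurd (((mem_regG_iff S c).1 hcreg).1 w.1.1 w.1.2 h) (by decide)
    have hχ1 : χ (zeroE c) = 1 := χ.one_of_mem_closedBall (Metric.ball_subset_closedBall hcball)
    -- the inner family at `c` IS the cut-off family at the spectator point `zeroE c`
    have hfun : INNER c = Bt (zeroE c) := by
      funext u
      rw [hBtdef]
      dsimp only
      rw [hχ1, Complex.ofReal_one, one_mul, hBΞ', hBΞ', hΞE c (zeroE c) _ fun w hw => (hzeroE_off c w hw).symm]
    have hσ : ∀ (h : {w : {w : {w : InfinitePlace L // IsComplex w} // w ∉ S} // w.1 ∈ E} → ↥(unitaryGroupOfForm (starRingEnd ℂ) J)) (w : {w : {w : {w : InfinitePlace L // IsComplex w} // w ∉ S} // w.1 ∈ E}),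
        (MeasurableEquiv.piCongrLeft (fun _ : ↥E => ↥(unitaryGroupOfForm (starRingEnd ℂ) J)) σ h) (σ w) = h w :=
      fun h w => MeasurableEquiv.piCongrLeft_apply_apply (β := fun _ : ↥E => ↥(unitaryGroupOfForm (starRingEnd ℂ) J)) σ h w
    -- the output integral over `U(J)^E`, read over `U(J)^{ιE}` along `σ`, is `R′ c` times ★ L1^ι's right-hand side integral
    have hI : ∫ h : ↥E → ↥(unitaryGroupOfForm (starRingEnd ℂ) J),
        (fun q : ({w : InfinitePlace L // IsComplex w} → Fin 3 → ℝ) × (↥E → Matrix (Fin 2) (Fin 2) ℂ) =>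
          R' q.1 * f ((zeroE q.1, fun w : {w : {w : {w : InfinitePlace L // IsComplex w} // w ∉ S} // w.1 ∈ E} => q.1 w.1.1), fun w : {w : {w : {w : InfinitePlace L // IsComplex w} // w ∉ S} // w.1 ∈ E} => q.2 (σ w)))
          (c, fun w : ↥E => (((h w * ⟨Matrix.GeneralLinearGroup.mkOfDetNeZero !![(1 : ℂ), 1; 1, -1] det_cayleyTwo_ne_zero *
                  circleDiagonal 2 ![Circle.exp (c w.1 0), Circle.exp (c w.1 2)] *
                  (Matrix.GeneralLinearGroup.mkOfDetNeZero !![(1 : ℂ), 1; 1, -1] det_cayleyTwo_ne_zero)⁻¹,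
                cayley_conj_circleDiagonal_mem_of_eq_over hJ _⟩ * (h w)⁻¹ : ↥(unitaryGroupOfForm (starRingEnd ℂ) J)) : GL (Fin 2) ℂ) : Matrix (Fin 2) (Fin 2) ℂ)) ∂(Measure.pi fun _ => μ₀) =
        R' c * ∫ h : {w : {w : {w : InfinitePlace L // IsComplex w} // w ∉ S} // w.1 ∈ E} → ↥(unitaryGroupOfForm (starRingEnd ℂ) J),
          f ((zeroE c, fun w : {w : {w : {w : InfinitePlace L // IsComplex w} // w ∉ S} // w.1 ∈ E} => c w.1.1), fun w : {w : {w : {w : InfinitePlace L // IsComplex w} // w ∉ S} // w.1 ∈ E} => (((h w * ⟨Matrix.GeneralLinearGroup.mkOfDetNeZero !![(1 : ℂ), 1; 1, -1] det_cayleyTwo_ne_zero *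
                  circleDiagonal 2 ![Circle.exp (c w.1.1 0), Circle.exp (c w.1.1 2)] *
                  (Matrix.GeneralLinearGroup.mkOfDetNeZero !![(1 : ℂ), 1; 1, -1] det_cayleyTwo_ne_zero)⁻¹,
                cayley_conj_circleDiagonal_mem_of_eq_over hJ _⟩ * (h w)⁻¹ : ↥(unitaryGroupOfForm (starRingEnd ℂ) J)) : GL (Fin 2) ℂ) : Matrix (Fin 2) (Fin 2) ℂ)) ∂(Measure.pi fun _ => μ₀) := by
      rw [← hΦU.integral_comp', ← integral_const_mul]
      refine integral_congr_ae (Filter.Eventually.of_forall fun h => ?_)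
      show R' c * f ((zeroE c, fun w : {w : {w : {w : InfinitePlace L // IsComplex w} // w ∉ S} // w.1 ∈ E} => c w.1.1), fun w : {w : {w : {w : InfinitePlace L // IsComplex w} // w ∉ S} // w.1 ∈ E} => (((
          (MeasurableEquiv.piCongrLeft (fun _ : ↥E => ↥(unitaryGroupOfForm (starRingEnd ℂ) J)) σ h) (σ w) *
            ⟨Matrix.GeneralLinearGroup.mkOfDetNeZero !![(1 : ℂ), 1; 1, -1] det_cayleyTwo_ne_zero *
                  circleDiagonal 2 ![Circle.exp (c w.1.1 0), Circle.exp (c w.1.1 2)] *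
                  (Matrix.GeneralLinearGroup.mkOfDetNeZero !![(1 : ℂ), 1; 1, -1] det_cayleyTwo_ne_zero)⁻¹,
                cayley_conj_circleDiagonal_mem_of_eq_over hJ _⟩ *
          ((MeasurableEquiv.piCongrLeft (fun _ : ↥E => ↥(unitaryGroupOfForm (starRingEnd ℂ) J)) σ h) (σ w))⁻¹ : ↥(unitaryGroupOfForm (starRingEnd ℂ) J)) :
            GL (Fin 2) ℂ) : Matrix (Fin 2) (Fin 2) ℂ)) = _
      simp only [hσ]
    rw [hA c hcreg, hfun, hid _ hcball _ hcV hoff, hPREF, hI]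
    ring


/-- **(X-core) HEAD — BOX DESCENT OF THE EXTENDED GENUINE FAMILY AT CROSS-PLACE CORNERS, REAL WALLS AT THE SPLIT PLACES ALLOWED.**  Frame: diagonal anisotropic `α` with
real weights at every place, any Haar `ν′` on `G′_∞`, `J = antidiag(1,1)` with any Haar `μ₀` on `U(J)(ℂ)`; split label `S` (admissible); a finite set `E` of compact-chart
places, disjoint from `S`, each in `splitChartPlaces`; base point `x` with a `(0,2)`-corner at every `w ∈ E` (`x_w 0 = x_w 2`, `e^{i x_w 1} ≠ e^{i x_w 0}`) and NO noncompact
coincidence at any other compact place (compact coincidences there and the split coordinates — real walls, scalar split points — are FREE); `a′ ∈ C_c^∞(G′_∞)`.  THEN there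
are `K ≠ 0`, an open `U ∋ x` and ONE jointly smooth `f : (coordinates) × M₂(ℂ)^E → ℂ`, compactly supported in the matrix variables uniformly, depending on `c` only through
the coordinates off `E` and the middle corner coordinates `(c_w 1)_{w ∈ E}`, such that `U` minus the corner walls lies in `InRegG` and, for every `c ∈ U` off the corner walls,
**`orbFamGExt L α ν′ a′ S c = (Π_{w ∈ E} (1 − e^{i(c_{w1}−c_{w0})})(1 − e^{i(c_{w2}−c_{w0})})(1 − e^{i(c_{w2}−c_{w1})})) · K · ∫_{U(J)^E} f(c, (↑↑(h_w · P diag(e^{ic_{w0}}, e^{ic_{w2}}) P⁻¹ · h_w⁻¹))_{w ∈ E}) dμ₀^{⊗E}(h)`**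
— §3 docked by §2. [cite: Rogawski1990, §4.12 Lemma 4.12.1 p. 61; §8.2 pp. 119–124] [cite: Varadarajan1977, I §1.12] [cite: Shelstad1979, §4 pp. 22–25]
[cite: Bouaziz1994IntegralesOrbitales, §3.1 (I₁) p. 579; §3.2 p. 580] -/
theorem exists_descent_box_orbFamGExt_inRegG_corners (hα : ∀ i, α i ≠ 0)
    (hreal : ∀ (w : {w : InfinitePlace L // IsComplex w}) (i : Fin 3), (w.1.embedding (α i)).im = 0)
    {J : Matrix (Fin 2) (Fin 2) ℂ} (hJ : J = (StdForm.antidiagonal 2).over ℂ)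
    [MeasurableSpace ↥(unitaryGroupOfForm (starRingEnd ℂ) J)] [BorelSpace ↥(unitaryGroupOfForm (starRingEnd ℂ) J)]
    [LocallyCompactSpace ↥(unitaryGroupOfForm (starRingEnd ℂ) J)] [SecondCountableTopology ↥(unitaryGroupOfForm (starRingEnd ℂ) J)]
    (μ₀ : Measure ↥(unitaryGroupOfForm (starRingEnd ℂ) J)) [μ₀.IsHaarMeasure] [μ₀.IsMulRightInvariant]
    {S E : Finset {w : InfinitePlace L // IsComplex w}} {x : {w : InfinitePlace L // IsComplex w} → Fin 3 → ℝ}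
    (hS : ∀ w, w ∈ S → w ∈ splitChartPlaces L α) (hE : ∀ w, w ∈ E → w ∉ S) (hEsp : ∀ w, w ∈ E → w ∈ splitChartPlaces L α)
    (hx02 : ∀ w, w ∈ E → x w 0 = x w 2) (hx1 : ∀ w, w ∈ E → Circle.exp (x w 1) ≠ Circle.exp (x w 0))
    (hxin : ∀ w, w ∉ S → w ∉ E → ∀ i j : Fin 3, i ≠ j → slotSign L α w i ≠ slotSign L α w j → Circle.exp (x w i) ≠ Circle.exp (x w j))
    {a' : ↥(arch (↥(maximalRealSubfield L)) L (IsCMField.complexConj L) 3 (Matrix.diagonal α)) → ℂ} (ha' : ArchSmooth L 3 (Matrix.diagonal α) a') :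
    ∃ (K : ℂ) (U : Set ({w : InfinitePlace L // IsComplex w} → Fin 3 → ℝ)) (f : ({w : InfinitePlace L // IsComplex w} → Fin 3 → ℝ) × (↥E → Matrix (Fin 2) (Fin 2) ℂ) → ℂ),
      K ≠ 0 ∧ IsOpen U ∧ x ∈ U ∧ ContDiff ℝ ∞ f ∧
      (∃ C : Set (↥E → Matrix (Fin 2) (Fin 2) ℂ), IsCompact C ∧ ∀ c X, X ∉ C → f (c, X) = 0) ∧
      (∀ c c' X, (∀ w, w ∉ E → c w = c' w) → (∀ w, w ∈ E → c w 1 = c' w 1) → f (c, X) = f (c', X)) ∧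
      (∀ c ∈ U, (∀ w ∈ E, Circle.exp (c w 0) ≠ Circle.exp (c w 2)) → c ∈ InRegG (slotSign L α) S) ∧
      ∀ c ∈ U, (∀ w ∈ E, Circle.exp (c w 0) ≠ Circle.exp (c w 2)) →
        orbFamGExt L α ν' a' S c =
          (∏ w ∈ E, ((1 - (Circle.exp (c w 1 - c w 0) : ℂ)) * (1 - (Circle.exp (c w 2 - c w 0) : ℂ)) * (1 - (Circle.exp (c w 2 - c w 1) : ℂ)))) *
          (K * ∫ h : ↥E → ↥(unitaryGroupOfForm (starRingEnd ℂ) J),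
            f (c, fun w => (((h w * ⟨Matrix.GeneralLinearGroup.mkOfDetNeZero !![(1 : ℂ), 1; 1, -1] det_cayleyTwo_ne_zero *
                  circleDiagonal 2 ![Circle.exp (c w.1 0), Circle.exp (c w.1 2)] *
                  (Matrix.GeneralLinearGroup.mkOfDetNeZero !![(1 : ℂ), 1; 1, -1] det_cayleyTwo_ne_zero)⁻¹,
                cayley_conj_circleDiagonal_mem_of_eq_over hJ _⟩ * (h w)⁻¹ : ↥(unitaryGroupOfForm (starRingEnd ℂ) J)) : GL (Fin 2) ℂ) : Matrix (Fin 2) (Fin 2) ℂ))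
            ∂(Measure.pi fun _ => μ₀)) := by
  obtain ⟨K, U, f, hK, hUo, hxU, hf, hfC, hft, hU7, hcore⟩ :=
    exists_descent_box_orbFamG_cornerPackage L α ν' hα hreal hJ μ₀ hS hE hEsp hx02 hx1 hxin ha'
  exact exists_descent_box_orbFamGExt_inRegG_corners_of_core L α ν' hJ μ₀ hK hUo hxU hf hfC hft hU7 hcore

end Core

end Literature.NumberTheory.Rogawski1990

end
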